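import Summits.AtomisticToContinuum.HydrodynamicLimit.Theorems.InformationPercolationEngineChaosClosesEulerReductionFields
import Summits.AtomisticToContinuum.HydrodynamicLimit.Theorems.InformationPercolationEngineChaosClosesEulerReductionEvents
import Summits.AtomisticToContinuum.HydrodynamicLimit.Theorems.InformationPercolationEngineChaosClosesEulerMassBalance
import HarnessLib

/-!
# Kinetic reduction (crux `ChaosClosesEuler`, stmt-AtomisticToContinuum-15141, line `Sketch`,
# stub `stub_kineticReduction`) — helper: the structural, mass, energy and initial inputs of the shell

WHAT. Along ONE good orbit, the field `V(s, x) = (ρ_r, m_r, e_r)(Φₛz)(x)` fed to the BF18 shell satisfies its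
structural hypotheses (H0: joint measurability, SOME sup bound, `ρ_r ≥ 0`, admissibility `‖m_r‖² ≤ 2ρ_r e_r`), the
EXACT continuity equation (H1) against every test smooth on space–time (the landed `stub_massBalance`), the global
energy inequality (H4) with room `δ` (energy is conserved exactly and `∫ e_r = ke`), and the sup-closeness (H5) at
`τ = 0` off the three events of `InitialLayer`. Also the last step of the reduction: the shell's window bound summed
over the `m + 1` consecutive windows tiling `[t, t + Δ']` contradicts the deviation event of
`MollifiedCloseTimeAveraged` (`shell_windows_sum_le`).

No named fact is invoked.
-/

noncomputable section

namespace Summit.AtomisticToContinuum.HydrodynamicLimit.Theorems.ChaosClosesEulerReduction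

open scoped BigOperators Topology Classical MeasureTheory ENNReal InnerProductSpace
open Filter Set MeasureTheory Function
open Literature.MathematicalPhysics.KineticTheory
open Literature.Analysis.FluidPDE
open Literature.Analysis.FunctionSpaces
open Summit.AtomisticToContinuum.HydrodynamicLimit.Theorems.LocalSecondLawNegative
open Summit.AtomisticToContinuum.HydrodynamicLimit.Theorems.LocalSecondLawLedger

variable {N : ℕ}

/-! ## §1 (H0) structure of the field -/

/-- **(H0a) joint measurability of `V` along a good orbit.** [folklore] -/
theorem shell_measurable {σ : ℝ} (Φ : HardSphereFlow (Torus.geometry (Fin 3)) (hsDiameter σ N) (N + 1))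
    {z : Phase N} (hz : z ∈ Φ.good) (r : ℝ) :
    Measurable (uncurry fun s x => (rhoC r (Φ.flow s z) x, momC r (Φ.flow s z) x, kinC r (Φ.flow s z) x)) :=
  measurable_V_orbit (Φ.isTrajectory z hz).measurable_torus r

/-- **(H0b) a sup bound of `V` along a good orbit** (`r`-dependent; the shell asks for SOME bound). [folklore] -/
theorem shell_bounded {σ : ℝ} (Φ : HardSphereFlow (Torus.geometry (Fin 3)) (hsDiameter σ N) (N + 1))
    {z : Phase N} (hz : z ∈ Φ.good) {r : ℝ} (hr : 0 < r) :
    ∃ C : ℝ, ∀ s x, |rhoC r (Φ.flow s z) x| ≤ C ∧ ‖momC r (Φ.flow s z) x‖ ≤ C ∧ |kinC r (Φ.flow s z) x| ≤ C := by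
  have hke : ∀ s, ke (Φ.flow s z) = ke z := fun s => ke_flow_eq Φ hz s
  refine ⟨3 / (Real.pi * r ^ 3) * (1 + ke z), fun s x => ⟨?_, ?_, ?_⟩⟩
  · rw [abs_of_nonneg (rhoC_nonneg hr _ _)]
    calc rhoC r (Φ.flow s z) x ≤ 3 / (Real.pi * r ^ 3) := rhoC_le hr _ _
      _ ≤ 3 / (Real.pi * r ^ 3) * (1 + ke z) :=
          le_mul_of_one_le_right (by positivity) (by linarith [ke_nonneg z])
  · calc ‖momC r (Φ.flow s z) x‖ ≤ 3 / (Real.pi * r ^ 3) * (1 / 2 + ke (Φ.flow s z)) := norm_momC_le hr _ _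
      _ ≤ 3 / (Real.pi * r ^ 3) * (1 + ke z) := by rw [hke s]; gcongr; norm_num
  · rw [abs_of_nonneg (kinC_nonneg hr _ _)]
    calc kinC r (Φ.flow s z) x ≤ 3 / (Real.pi * r ^ 3) * ke (Φ.flow s z) := psvK_kinC_le hr _ _
      _ ≤ 3 / (Real.pi * r ^ 3) * (1 + ke z) := by rw [hke s]; gcongr; linarith

/-- **(H0c) nonnegativity and (H0d) admissibility.** [folklore] -/
theorem shell_nonneg_admissible {σ : ℝ} (Φ : HardSphereFlow (Torus.geometry (Fin 3)) (hsDiameter σ N) (N + 1))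
    (z : Phase N) {r : ℝ} (hr : 0 < r) :
    (∀ (s : ℝ) (x : T3), 0 ≤ rhoC r (Φ.flow s z) x) ∧
    ∀ (s : ℝ) (x : T3), ‖momC r (Φ.flow s z) x‖ ^ 2 ≤ 2 * rhoC r (Φ.flow s z) x * kinC r (Φ.flow s z) x :=
  ⟨fun _ _ => rhoC_nonneg hr _ _, fun _ _ => norm_momC_sq_le hr _ _⟩

/-! ## §2 (H1) exact continuity equation, (H4) energy -/

/-- **(H1) the exact continuity equation of the cone density**, in the shell's format, from the landed
`stub_massBalance`. [folklore] -/
theorem shell_mass {σ : ℝ} (hσ : 0 < σ) (hσ2 : σ < 2⁻¹)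
    (Φ : HardSphereFlow (Torus.geometry (Fin 3)) (hsDiameter σ N) (N + 1)) {z : Phase N} (hz : z ∈ Φ.good)
    {r : ℝ} (hr : 0 < r) (hr2 : r < 2⁻¹) (t : ℝ) :
    ∀ φ : ℝ → T3 → ℝ, Torus.IsSmoothSpaceTimeOn Set.univ φ → ∀ τ ∈ Set.Icc 0 t,
      (∫ x, φ τ x * rhoC r (Φ.flow τ z) x) - ∫ x, φ 0 x * rhoC r (Φ.flow 0 z) x =
        ∫ s in Set.Icc 0 τ, ∫ x, (deriv (fun s' => φ s' x) s * rhoC r (Φ.flow s z) x +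
          ∑ k : Fin 3, momC r (Φ.flow s z) x k * Torus.partialDeriv k (φ s) x) := by
  intro φ hφ τ hτ
  have h := ChaosClosesEulerMassBalance.stub_massBalance σ hσ hσ2 N Φ z hz r hr hr2 φ hφ τ hτ.1
  exact h

/-- **(H4) the global energy inequality with room `δ`** (exact conservation, `∫ e_r = ke`). [folklore] -/
theorem shell_energy {σ : ℝ} (Φ : HardSphereFlow (Torus.geometry (Fin 3)) (hsDiameter σ N) (N + 1))
    {z : Phase N} (hz : z ∈ Φ.good) {r : ℝ} (hr : 0 < r) (hr2 : r < 1 / 2) {δ : ℝ} (hδ : 0 ≤ δ) (t : ℝ) :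
    ∀ τ ∈ Set.Icc 0 t, ∫ x, kinC r (Φ.flow τ z) x ≤ (∫ x, kinC r (Φ.flow 0 z) x) + δ := by
  intro τ _
  rw [integral_kinC_eq_ke hr hr2, integral_kinC_eq_ke hr hr2, ke_flow_eq Φ hz τ, ke_flow_eq Φ hz 0]
  linarith

/-! ## §3 (H5) the initial layer off its three events -/

/-- **(H5) sup-closeness at `τ = 0` off the three events of `InitialLayer`.** [folklore] -/
theorem shell_initial {σ : ℝ} (Φ : HardSphereFlow (Torus.geometry (Fin 3)) (hsDiameter σ N) (N + 1))
    {z : Phase N} {r δ : ℝ} {ρ θ : ℝ → T3 → ℝ} {u : ℝ → T3 → V3}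
    (n1 : z ∉ {z : Phase N | ∃ x, δ < |empiricalDensityField (Φ.flow 0 z)
      (fun y => 3 / (Real.pi * r ^ 3) * max (1 - Torus.euclidDist y x / r) 0) - ρ 0 x|})
    (n2 : z ∉ {z : Phase N | ∃ x, δ < ‖empiricalMomentumField (Φ.flow 0 z)
      (fun y => 3 / (Real.pi * r ^ 3) * max (1 - Torus.euclidDist y x / r) 0) - ρ 0 x • u 0 x‖})
    (n3 : z ∉ {z : Phase N | ∃ x, δ < |empiricalEnergyField (Φ.flow 0 z)
      (fun y => 3 / (Real.pi * r ^ 3) * max (1 - Torus.euclidDist y x / r) 0) - totalEnergyDensity (ρ 0 x) (u 0 x) (θ 0 x)|}) :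
    ∀ x, |rhoC r (Φ.flow 0 z) x - ρ 0 x| ≤ δ ∧ ‖momC r (Φ.flow 0 z) x - ρ 0 x • u 0 x‖ ≤ δ ∧
      |kinC r (Φ.flow 0 z) x - totalEnergyDensity (ρ 0 x) (u 0 x) (θ 0 x)| ≤ δ := by
  simp only [Set.mem_setOf_eq, not_exists, not_lt] at n1 n2 n3
  exact fun x => ⟨n1 x, n2 x, n3 x⟩

/-! ## §4 The conclusion from the shell's window bound -/

/-- **The window bounds of the shell tile the conclusion's window.** If the sum of the three `L¹(dx)` errors,
integrable in time on `[t, t + (m+1)Δ]`, has `∫_{[τ₀, τ₀+Δ]} ≤ εΔ` for each `τ₀ = t + jΔ`, `j ≤ m`, then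
`∫_{[t, t+(m+1)Δ]} ≤ ε (m+1) Δ`. [folklore] -/
theorem shell_windows_sum_le {f : ℝ → ℝ} {t Δ ε : ℝ} (hΔ : 0 < Δ) (m : ℕ)
    (hf : IntegrableOn f (Icc t (t + (m + 1 : ℕ) * Δ)) volume)
    (hw : ∀ j : ℕ, j < m + 1 → ∫ s in Icc (t + j * Δ) (t + j * Δ + Δ), f s ≤ ε * Δ) :
    ∫ s in Icc t (t + (m + 1 : ℕ) * Δ), f s ≤ ε * ((m + 1 : ℕ) * Δ) := by
  rw [setIntegral_Icc_eq_sum_windows hΔ m hf]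
  calc ∑ j ∈ Finset.range (m + 1), ∫ s in Icc (t + j * Δ) (t + (j + 1) * Δ), f s
      ≤ ∑ _j ∈ Finset.range (m + 1), ε * Δ := Finset.sum_le_sum fun j hj => by
        have h := hw j (Finset.mem_range.1 hj)
        rwa [show t + (j : ℝ) * Δ + Δ = t + ((j : ℝ) + 1) * Δ by ring] at h
    _ = ε * ((m + 1 : ℕ) * Δ) := by
        rw [Finset.sum_const, Finset.card_range, nsmul_eq_mul]; push_cast; ring

/-- **The route's tested cone fields are the cone fields** (definitionally). [folklore] -/
theorem err_eq (r : ℝ) (w : Phase N) (ρv : ℝ) (mv : V3) (ev : ℝ) (x : T3) :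
    |empiricalDensityField w (fun y => 3 / (Real.pi * r ^ 3) * max (1 - Torus.euclidDist y x / r) 0) - ρv| +
      ‖empiricalMomentumField w (fun y => 3 / (Real.pi * r ^ 3) * max (1 - Torus.euclidDist y x / r) 0) - mv‖ +
      |empiricalEnergyField w (fun y => 3 / (Real.pi * r ^ 3) * max (1 - Torus.euclidDist y x / r) 0) - ev| =
    |rhoC r w x - ρv| + ‖momC r w x - mv‖ + |kinC r w x - ev| := rfl

/-! ## §5 The registered sub-goal -/

/-- **Registered sub-goal `stub_reductionShellInputs` (helper of `stub_kineticReduction`): the global energy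
inequality (H4) of the shell for the cone field holds with any room `δ ≥ 0`** — kinetic energy is conserved exactly
along a good orbit and the cone kinetic energy integrates to it. [folklore] -/
theorem stub_reductionShellInputs : ∀ {N : ℕ} {σ : ℝ} (Φ : HardSphereFlow (Torus.geometry (Fin 3)) (hsDiameter σ N) (N + 1)) {z : Config (N + 1) (Fin 3) T3}, z ∈ Φ.good → ∀ {r : ℝ}, 0 < r → r < 1 / 2 → ∀ {δ : ℝ}, 0 ≤ δ → ∀ (t : ℝ), ∀ τ ∈ Set.Icc 0 t, ∫ x, kinC r (Φ.flow τ z) x ≤ (∫ x, kinC r (Φ.flow 0 z) x) + δ :=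
  fun Φ _ hz _ hr hr2 _ hδ t => shell_energy Φ hz hr hr2 hδ t

end Summit.AtomisticToContinuum.HydrodynamicLimit.Theorems.ChaosClosesEulerReduction

end
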